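import Summits.BirchSwinnertonDyer.BirchSwinnertonDyer.Theorems.CyclotomicUntwistSecondKindLogClasses
import Summits.BirchSwinnertonDyer.BirchSwinnertonDyer.Theorems.CyclotomicUntwistGNineSpecialFibrePointCount
import HarnessLib

/-!
# Route `CyclotomicUntwist`: the source side of the D5 pin ON THE K1/K2 ROWS — Katz's classes `[log₀]`,
# `[log₀(T³)]` of the canonical `ℤ₃`-lift `y² = x³ − x + b` of the special fibre, their independence and their
# Frobenius matrix (companion of `X² − a_w X + 3`)

Cell `pub/bsd-wall` (D-0145 line `route-BirchSwinnertonDyer-CyclotomicUntwist`), prover seat `bsd-line-cycu-p2`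
(gen 6), lane «D5 TYPING» (memo `Cruxes/PSRankOneLowerHalfAtThree/D5-TYPING-v1.md` §2–§3); sequel of
`CyclotomicUntwistSecondKindLogClasses` (the general supersingular Honda-logarithm statements). THEOREMS ONLY (no
definition, no named fact, no instance, no `sorry`); helper `--supports` K1 = stmt-BirchSwinnertonDyer-21580 (serves
K2 = 21581 equally). BSD is not proved by this file and no crux is.

For every `b : ℤ₃` the Weierstrass equation `V₀ = ⟨0, 0, 0, −1, b⟩` over `ℤ₃` — on a K1/K2 row with
`b̄ = −a_w/3` it is the CANONICAL lift of the special fibre `Ē_w : y² = x³ − x + b̄` of the good model over `ℚ₃(ζ₉)`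
(`CyclotomicUntwistGNineSpecialFibre`, p610052) — has elliptic generic and special fibres (`map_coe_lift`,
`isElliptic_map_coe_lift`: `‖Δ‖₃ = ‖64 − 432b²‖₃ = 1`; `isElliptic_map_toZMod_lift`), special-fibre trace
`a = HasseManin.tr = −3·valMinAbs b̄ ∈ {0, ±3}` (`tr_lift`, from cycu-p3 g6's point count
`GNineSpecialFibrePointCount.trace_specialFibre`), hence `‖a‖₃ ≤ 3⁻¹` (`norm_tr_lift_le`: SUPERSINGULAR) and the
tree's Honda congruence applies (`hondaShift_log_lift`). **`source_side_lift`** packages, for `log₀ = log_{V₀}`: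
(i) `‖[X^{9ᵏ}] log₀‖ = 3ᵏ`, `‖[X^{3·9ᵏ}] log₀‖ ≤ 3ᵏ` (`[log₀] ≠ 0` in Katz's `D_ℚ`); (ii) over every ultrametric
normed field `K ⊇ ℚ₃` (e.g. `ℚ₃(ζ₉)`, `ℂ₃`), `x·log₀ + y·log₀(X³)` has bounded coefficients only for `x = y = 0`
(the (u)-engine of the memo's predicate: the four `L`-numbers `(a, b, c, d)` are unique); (iii)
`log₀(X⁹) − a·log₀(X³) + 3·log₀` has coefficients of norm `≤ 3⁻¹` — Frobenius `f ↦ f(X³)` acts on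
`([log₀], [log₀(X³)])` by the companion matrix of `X² − aX + 3` (trace `a = a_w`, determinant `3`), the relation
that `CyclotomicUntwistDescendedFrobeniusRational.descended_api_of_cyclic_relation` converts into the pen's (t), (g).
[cite: Katz1981CrystallineDieudonne, §5 (5.1.2–5.1.4)] [cite: Honda1970, Thm. 9] [cite: BerthelotOgus1983, Thm. 2.4]
-/

set_option autoImplicit false
-- single-conjunct summit: `Summit.BirchSwinnertonDyer.BirchSwinnertonDyer.…` repeats the name by design
set_option linter.dupNamespace false

noncomputable section

open PowerSeries Literature.RingTheory.FormalGroups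

namespace Summit.BirchSwinnertonDyer.BirchSwinnertonDyer.Theorems.SecondKindLogClasses

/-! ## At `p = 3` on the canonical lifts `V₀ = ⟨0, 0, 0, −1, b⟩ / ℤ₃` of the K1/K2 special fibres -/

section Rows

open Summit.BirchSwinnertonDyer.BirchSwinnertonDyer.Theorems.GNineSpecialFibrePointCount
  Literature.NumberTheory.EllipticCurves

/-- The lift reduces to the special fibre `y² = x³ − x + b̄`. [folklore] -/
theorem map_toZMod_lift (b : ℤ_[3]) :
    (⟨0, 0, 0, -1, b⟩ : WeierstrassCurve ℤ_[3]).map PadicInt.toZMod = ⟨0, 0, 0, -1, PadicInt.toZMod b⟩ := by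
  simp [WeierstrassCurve.map]

/-- The lift read in `ℚ₃` is `⟨0, 0, 0, −1, b⟩`. [folklore] -/
theorem map_coe_lift (b : ℤ_[3]) :
    (⟨0, 0, 0, -1, b⟩ : WeierstrassCurve ℤ_[3]).map PadicInt.Coe.ringHom = ⟨0, 0, 0, -1, (b : ℚ_[3])⟩ := by
  simp [WeierstrassCurve.map]

/-- The special fibre of the lift is elliptic (`Δ = 1` in `𝔽₃`). [cite: SilvermanAEC2009, VII.5] -/
theorem isElliptic_map_toZMod_lift (b : ℤ_[3]) :
    ((⟨0, 0, 0, -1, b⟩ : WeierstrassCurve ℤ_[3]).map PadicInt.toZMod).IsElliptic := by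
  rw [map_toZMod_lift]; exact isElliptic_specialFibre _

/-- The generic fibre of the lift is elliptic: `Δ = 64 − 432b²` has norm `1`. [cite: SilvermanAEC2009, VII.5] -/
theorem isElliptic_map_coe_lift (b : ℤ_[3]) :
    ((⟨0, 0, 0, -1, b⟩ : WeierstrassCurve ℤ_[3]).map PadicInt.Coe.ringHom).IsElliptic := by
  rw [map_coe_lift]
  refine ⟨?_⟩
  have hΔ : (⟨0, 0, 0, -1, (b : ℚ_[3])⟩ : WeierstrassCurve ℚ_[3]).Δ = 64 - 432 * (b : ℚ_[3]) ^ 2 := by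
    simp only [WeierstrassCurve.Δ, WeierstrassCurve.b₂, WeierstrassCurve.b₄, WeierstrassCurve.b₆,
      WeierstrassCurve.b₈]
    ring
  rw [hΔ, isUnit_iff_ne_zero]
  intro h0
  have h64 : ‖(64 : ℚ_[3])‖ = 1 := by
    rw [show (64 : ℚ_[3]) = ((64 : ℕ) : ℚ_[3]) by norm_cast, Padic.norm_natCast_eq_one_iff]; decide
  have h432 : ‖(432 : ℚ_[3]) * (b : ℚ_[3]) ^ 2‖ < 1 := by
    rw [norm_mul, norm_pow]
    have h1 : ‖(432 : ℚ_[3])‖ < 1 := by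
      rw [show (432 : ℚ_[3]) = ((432 : ℕ) : ℚ_[3]) by norm_cast, Padic.norm_natCast_lt_one_iff]; decide
    have h2 : ‖(b : ℚ_[3])‖ ^ 2 ≤ 1 := pow_le_one₀ (norm_nonneg _) (PadicInt.norm_le_one b)
    calc ‖(432 : ℚ_[3])‖ * ‖(b : ℚ_[3])‖ ^ 2 ≤ ‖(432 : ℚ_[3])‖ * 1 := by gcongr
      _ < 1 := by rw [mul_one]; exact h1
  have : (64 : ℚ_[3]) = 432 * (b : ℚ_[3]) ^ 2 := sub_eq_zero.mp h0
  rw [this] at h64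
  exact absurd h64 h432.ne

/-- **The Frobenius trace of the lift's special fibre is `a = −3·valMinAbs b̄ ∈ {0, ±3}`** (cycu-p3 g6's point count),
as the integer `HasseManin.tr`. [cite: SilvermanAEC2009, V.2] -/
theorem tr_lift (b : ℤ_[3]) :
    HasseManin.tr ((⟨0, 0, 0, -1, b⟩ : WeierstrassCurve ℤ_[3]).map PadicInt.toZMod) =
      -3 * ZMod.valMinAbs (PadicInt.toZMod b) := by
  rw [map_toZMod_lift, HasseManin.tr, ZMod.card]
  exact_mod_cast trace_specialFibre (PadicInt.toZMod b)

/-- `3 ∣ a`: the special fibre is SUPERSINGULAR; as a norm bound `‖a‖₃ ≤ 3⁻¹`. [cite: SilvermanAEC2009, Ex. V.4.4] -/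
theorem norm_tr_lift_le (b : ℤ_[3]) :
    ‖((HasseManin.tr ((⟨0, 0, 0, -1, b⟩ : WeierstrassCurve ℤ_[3]).map PadicInt.toZMod) : ℤ) : ℚ_[3])‖ ≤
      ((3 : ℕ) : ℝ)⁻¹ := by
  have h3 : ((3 : ℕ) : ℤ) ^ 1 ∣ HasseManin.tr ((⟨0, 0, 0, -1, b⟩ : WeierstrassCurve ℤ_[3]).map PadicInt.toZMod) := by
    rw [tr_lift, pow_one]; exact ⟨-ZMod.valMinAbs (PadicInt.toZMod b), by push_cast; ring⟩
  have := (Padic.norm_int_le_pow_iff_dvd _ 1).mpr h3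
  simpa using this

/-- **Honda for the canonical lift** (the tree's theorem, instantiated): `log₀ := log` of `⟨0,0,0,−1,b⟩` over `ℚ₃`
is of type `3 − aT + T²` with `a = −3·valMinAbs b̄`. [cite: Honda1970, Thm. 9] -/
theorem hondaShift_log_lift (b : ℤ_[3]) (n : ℕ) :
    ‖coeff n (hondaShift 3 (((-3 * ZMod.valMinAbs (PadicInt.toZMod b) : ℤ) : ℚ_[3]))
        ((⟨0, 0, 0, -1, (b : ℚ_[3])⟩ : WeierstrassCurve ℚ_[3]).formalLog))‖ ≤ 1 := by
  haveI := isElliptic_map_toZMod_lift b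
  haveI := isElliptic_map_coe_lift b
  have h := WeierstrassCurve.norm_coeff_hondaShift_formalLog_le_one
    (⟨0, 0, 0, -1, b⟩ : WeierstrassCurve ℤ_[3]) (by decide) n
  rwa [tr_lift, map_coe_lift] at h

/-- **THE SOURCE SIDE OF THE D5 PIN, in kernel.** For every `b : ℤ₃` (on the K1/K2 rows `b̄ = −a_w/3`), with
`log₀` the formal logarithm of `y² = x³ − x + b` over `ℚ₃` and `a = −3·valMinAbs b̄`:
(i) `‖[X^{9ᵏ}] log₀‖ = 3ᵏ`, `‖[X^{3·9ᵏ}] log₀‖ ≤ 3ᵏ` — `[log₀] ≠ 0` in Katz's `D_ℚ`;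
(ii) over every ultrametric normed field `K ⊇ ℚ₃`, `x·log₀ + y·log₀(X³)` has bounded coefficients only for
`x = y = 0` — `[log₀], [log₀(X³)]` are `K`-independent (the (u)-engine of the memo's predicate);
(iii) `log₀(X⁹) − a·log₀(X³) + 3·log₀` has coefficients of norm `≤ 3⁻¹` — Frobenius `f ↦ f(X³)` acts on
`([log₀], [log₀(X³)])` by the companion matrix of `X² − aX + 3`. [cite: Katz1981CrystallineDieudonne, §5]
[cite: Honda1970, Thm. 9] [cite: BerthelotOgus1983, Thm. 2.4] -/
theorem source_side_lift (b : ℤ_[3]) {K : Type*} [NormedField K] [NormedAlgebra ℚ_[3] K] [IsUltrametricDist K] :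
    (∀ k : ℕ, ‖coeff (3 ^ (2 * k)) ((⟨0, 0, 0, -1, (b : ℚ_[3])⟩ : WeierstrassCurve ℚ_[3]).formalLog)‖ = (3 : ℝ) ^ k ∧
        ‖coeff (3 ^ (2 * k + 1)) ((⟨0, 0, 0, -1, (b : ℚ_[3])⟩ : WeierstrassCurve ℚ_[3]).formalLog)‖ ≤ (3 : ℝ) ^ k) ∧
    (∀ (x y : K) (C : ℝ),
      (∀ n : ℕ, ‖coeff n (PowerSeries.C x *
          ((⟨0, 0, 0, -1, (b : ℚ_[3])⟩ : WeierstrassCurve ℚ_[3]).formalLog).map (algebraMap ℚ_[3] K) +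
        PowerSeries.C y * expand 3 (prime_ne_zero 3)
          (((⟨0, 0, 0, -1, (b : ℚ_[3])⟩ : WeierstrassCurve ℚ_[3]).formalLog).map (algebraMap ℚ_[3] K)))‖ ≤ C) →
      x = 0 ∧ y = 0) ∧
    (∀ n : ℕ, ‖coeff n (expand (3 ^ 2) (prime_sq_ne_zero 3)
          (⟨0, 0, 0, -1, (b : ℚ_[3])⟩ : WeierstrassCurve ℚ_[3]).formalLog -
        PowerSeries.C (((-3 * ZMod.valMinAbs (PadicInt.toZMod b) : ℤ) : ℚ_[3])) *
          expand 3 (prime_ne_zero 3) (⟨0, 0, 0, -1, (b : ℚ_[3])⟩ : WeierstrassCurve ℚ_[3]).formalLog +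
        PowerSeries.C ((3 : ℕ) : ℚ_[3]) * (⟨0, 0, 0, -1, (b : ℚ_[3])⟩ : WeierstrassCurve ℚ_[3]).formalLog)‖ ≤
      ((3 : ℕ) : ℝ)⁻¹) := by
  have hT := hondaShift_log_lift b
  have ha : ‖(((-3 * ZMod.valMinAbs (PadicInt.toZMod b) : ℤ) : ℚ_[3]))‖ ≤ ((3 : ℕ) : ℝ)⁻¹ := by
    have := norm_tr_lift_le b; rwa [tr_lift] at this
  have h1 : coeff 1 ((⟨0, 0, 0, -1, (b : ℚ_[3])⟩ : WeierstrassCurve ℚ_[3]).formalLog) = 1 :=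
    WeierstrassCurve.coeff_one_formalLog _
  refine ⟨fun k ↦ ?_, fun x y C hb ↦ eq_zero_of_norm_coeff_combination_le ha h1 hT hb,
    fun n ↦ norm_coeff_frobenius_relation_le hT n⟩
  have := norm_coeff_pow_pattern ha h1 hT k
  simpa using this

end Rows

end Summit.BirchSwinnertonDyer.BirchSwinnertonDyer.Theorems.SecondKindLogClasses
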